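import Mathlib
import HarnessLib
import Literature.Analysis.FluidPDE.VectorCalculus
import Summits.NavierStokesRegularity.NavierStokesRegularity.Theorems.UnthreadedRigidityDoorUnthreadedRigidityVirialHornAngularKey
import Summits.NavierStokesRegularity.NavierStokesRegularity.Theorems.UnthreadedRigidityDoorUnthreadedRigidityVirialHornAngularJets

/-!
# Route `UnthreadedRigidityDoor`, item `UnthreadedRigidity` (W2, stmt-NavierStokesRegularity-27585) — LINE g11-1 «VIRIAL HORN»:
# S-C `AngularLemma` BY NAME, in every degree — a solid harmonic with `{Y,|∇Y|²} ≡ 0` is zonal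

Prover file (engine-1 g71, free prover hand; `--supports stmt-NavierStokesRegularity-27585 --as helper`) for LINE g11-1 «VIRIAL HORN»
of planner ns-idea-6 g11 (objects BY NAME in `…VirialHornDefs.lean`, p695782; degrees `l ≤ 2` were `angularLemma_one/two`, p700578, ns-crc-p1 g7).

`angularLemma_holds : AngularLemma`.  PROOF (no Riemannian geometry on `S²` is used; everything is ℝ³ vector calculus):
* if the rotation field `R = y × ∇Y` vanishes identically, `Y` is zonal about every axis (`det[a, y, ∇Y] = ⟪a, y × ∇Y⟫`);
* otherwise pick `y₀` with `R(y₀) ≠ 0` and form the AXIS FIELD `A = ∇Y + c·y`, `c = −⟪Hess Y·R, R⟫/‖R‖²` near `y₀` (the axis of the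
  osculating circle of the level curve of `Y|_{S²}`, rewritten with `ΔY = 0`); the quotient rule gives `HasFDerivAt A A′`, and the pointwise
  KEY identity `cross_axisDeriv_axis_eq_zero` (`…VirialHornAngularKey`, fed by the jets of `…VirialHornAngularJets`) says `A′v × A = 0`;
* a field whose derivative is everywhere parallel to itself has constant direction on a ball (`parallel_of_cross_fderiv_eq_zero`: the ratios
  `⟪A, w⟫/⟪A, A(y₀)⟫` have zero derivative), so `det[A(y₀), y, ∇Y(y)] = 0` on a ball;
* `y ↦ det[a, y, ∇Y(y)]` is real-analytic (polynomial), so it vanishes identically (`IsSolidHarmonic.isZonalAbout_of_ball`).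

HONEST LABEL: support S-C of a RUNG line about SPECIAL separable data (Cartan/isoparametric rigidity of spherical harmonics); `UnthreadedRigidity`
(27585), W2 and NS regularity remain OPEN; nothing here is a statement about the Navier–Stokes equations.  0 kit.
-/

-- the summit and its single sub-problem share the name (CONVENTIONS §1), as in every Theorems file
set_option linter.dupNamespace false

namespace Summit.NavierStokesRegularity.NavierStokesRegularity.Theorems.UnthreadedRigidity.VirialHorn

open scoped InnerProductSpace Topology ContDiff
open Filter Set Metric
open Literature.Analysis.FluidPDE (cross crossCLM hasFDerivAt_cross)
open Summit.NavierStokesRegularity.NavierStokesRegularity.Theorems.UnthreadedRigidity.ProfileHorn (E3)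

/-! ## Private coordinate copies of generic cross-product facts -/

/-- a component of the cross product (private copy). -/
private theorem cross_apply_zero (u v : E3) : cross u v 0 = u 1 * v 2 - u 2 * v 1 := by
  simp [cross, cross_apply]

/-- a component of the cross product (private copy). -/
private theorem cross_apply_one (u v : E3) : cross u v 1 = u 2 * v 0 - u 0 * v 2 := by
  simp [cross, cross_apply]

/-- a component of the cross product (private copy). -/
private theorem cross_apply_two (u v : E3) : cross u v 2 = u 0 * v 1 - u 1 * v 0 := by
  simp [cross, cross_apply]

/-- the inner product in coordinates (private copy). -/
private theorem real_inner_e3 (u v : E3) : ⟪u, v⟫_ℝ = u 0 * v 0 + u 1 * v 1 + u 2 * v 2 := by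
  simp [PiLp.inner_apply, Fin.sum_univ_three, mul_comm]

/-- `u × (v × w) = ⟪u,w⟫ v − ⟪u,v⟫ w` (private copy). -/
private theorem cross_cross_eq (u v w : E3) : cross u (cross v w) = ⟪u, w⟫_ℝ • v - ⟪u, v⟫_ℝ • w := by
  ext i
  fin_cases i <;> simp [cross_apply_zero, cross_apply_one, cross_apply_two, real_inner_e3] <;> ring

/-- anticommutativity (private copy). -/
private theorem cross_anticomm' (u v : E3) : cross v u = -cross u v := by
  ext i
  fin_cases i <;> simp [cross_apply_zero, cross_apply_one, cross_apply_two] <;> ring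

/-- `⟪u × v, u⟫ = 0` (private copy). -/
private theorem inner_cross_self_fst (u v : E3) : ⟪cross u v, u⟫_ℝ = 0 := by
  rw [real_inner_e3, cross_apply_zero, cross_apply_one, cross_apply_two]; ring

/-- `⟪u × v, v⟫ = 0` (private copy). -/
private theorem inner_cross_self_snd (u v : E3) : ⟪cross u v, v⟫_ℝ = 0 := by
  rw [real_inner_e3, cross_apply_zero, cross_apply_one, cross_apply_two]; ring

/-- parallel vectors from a vanishing cross product: `X × Z = 0 ⇒ ‖Z‖² X = ⟪Z, X⟫ Z`. -/
private theorem smul_eq_of_cross_eq_zero {X Z : E3} (h : cross X Z = 0) : ⟪Z, Z⟫_ℝ • X = ⟪Z, X⟫_ℝ • Z := by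
  have := cross_cross_eq Z X Z
  rw [h] at this
  have h0 : cross Z (0 : E3) = 0 := by
    ext i; fin_cases i <;> simp [cross_apply_zero, cross_apply_one, cross_apply_two]
  rw [h0] at this
  exact (sub_eq_zero.mp this.symm)

/-! ## Constant direction from a derivative parallel to the field -/

/-- A differentiable field on a ball whose derivative is everywhere parallel to the field, and which stays non-orthogonal to its value at the
centre, is everywhere parallel to that value: `‖F(y₀)‖² F(y) = ⟪F(y), F(y₀)⟫ F(y₀)`.  (The ratios `⟪F, w⟫/⟪F, F(y₀)⟫` have zero derivative.) -/
theorem parallel_of_cross_fderiv_eq_zero {F : E3 → E3} {F' : E3 → E3 →L[ℝ] E3} {y₀ : E3} {r : ℝ}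
    (hF : ∀ y ∈ ball y₀ r, HasFDerivAt F (F' y) y) (hpar : ∀ y ∈ ball y₀ r, ∀ v, cross (F' y v) (F y) = 0)
    (hne : ∀ y ∈ ball y₀ r, ⟪F y, F y₀⟫_ℝ ≠ 0) {y : E3} (hy : y ∈ ball y₀ r) :
    ⟪F y₀, F y₀⟫_ℝ • F y = ⟪F y, F y₀⟫_ℝ • F y₀ := by
  have hr : 0 < r := nonempty_ball.mp ⟨y, hy⟩
  -- the ratio functions are constant on the ball
  have hconst : ∀ w : E3, ⟪F y, w⟫_ℝ * (⟪F y, F y₀⟫_ℝ)⁻¹ = ⟪F y₀, w⟫_ℝ * (⟪F y₀, F y₀⟫_ℝ)⁻¹ := by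
    intro w
    -- derivative of the ratio at every point of the ball
    have hder : ∀ z ∈ ball y₀ r, HasFDerivAt (fun z => ⟪F z, w⟫_ℝ * (⟪F z, F y₀⟫_ℝ)⁻¹) (0 : E3 →L[ℝ] ℝ) z := by
      intro z hz
      have h1 : HasFDerivAt (fun z => ⟪F z, w⟫_ℝ) ((fderivInnerCLM ℝ (F z, w)).comp ((F' z).prod 0)) z :=
        (hF z hz).inner (𝕜 := ℝ) (hasFDerivAt_const w z)
      have h2 : HasFDerivAt (fun z => ⟪F z, F y₀⟫_ℝ) ((fderivInnerCLM ℝ (F z, F y₀)).comp ((F' z).prod 0)) z :=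
        (hF z hz).inner (𝕜 := ℝ) (hasFDerivAt_const (F y₀) z)
      have h3 : HasFDerivAt (fun z => (⟪F z, F y₀⟫_ℝ)⁻¹)
          ((ContinuousLinearMap.toSpanSingleton ℝ (-(⟪F z, F y₀⟫_ℝ ^ 2)⁻¹)).comp
            ((fderivInnerCLM ℝ (F z, F y₀)).comp ((F' z).prod 0))) z :=
        (hasFDerivAt_inv (hne z hz)).comp z h2
      have h4 := h1.mul h3
      refine h4.congr_fderiv ?_
      ext v
      -- parallelism at `z`: `‖F‖² F′v = ⟪F, F′v⟫ F`
      have hp := smul_eq_of_cross_eq_zero (hpar z hz v)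
      have hFz : ⟪F z, F z⟫_ℝ ≠ 0 := by
        intro h0
        have : F z = 0 := inner_self_eq_zero.mp h0
        exact hne z hz (by rw [this, inner_zero_left])
      have e1 : ⟪F z, F z⟫_ℝ * ⟪F' z v, w⟫_ℝ = ⟪F z, F' z v⟫_ℝ * ⟪F z, w⟫_ℝ := by
        have := congrArg (fun u => ⟪u, w⟫_ℝ) hp
        simpa only [real_inner_smul_left] using this
      have e2 : ⟪F z, F z⟫_ℝ * ⟪F' z v, F y₀⟫_ℝ = ⟪F z, F' z v⟫_ℝ * ⟪F z, F y₀⟫_ℝ := by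
        have := congrArg (fun u => ⟪u, F y₀⟫_ℝ) hp
        simpa only [real_inner_smul_left] using this
      simp only [_root_.add_apply, _root_.smul_apply, ContinuousLinearMap.comp_apply,
        ContinuousLinearMap.prod_apply, fderivInnerCLM_apply, _root_.zero_apply, inner_zero_right, zero_add,
        ContinuousLinearMap.toSpanSingleton_apply, smul_eq_mul]
      -- goal: `⟪F z,w⟫ * (⟪F′v, F y₀⟫ * (−(q²)⁻¹)) + q⁻¹ * ⟪F′v, w⟫ = 0`
      have hq := hne z hz
      have key : ⟪F z, F z⟫_ℝ * (⟪F z, w⟫_ℝ * (⟪F' z v, F y₀⟫_ℝ * -(⟪F z, F y₀⟫_ℝ ^ 2)⁻¹)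
          + (⟪F z, F y₀⟫_ℝ)⁻¹ * ⟪F' z v, w⟫_ℝ) = 0 := by
        have : ⟪F z, F z⟫_ℝ * (⟪F z, w⟫_ℝ * (⟪F' z v, F y₀⟫_ℝ * -(⟪F z, F y₀⟫_ℝ ^ 2)⁻¹)
            + (⟪F z, F y₀⟫_ℝ)⁻¹ * ⟪F' z v, w⟫_ℝ)
            = ⟪F z, w⟫_ℝ * (⟪F z, F z⟫_ℝ * ⟪F' z v, F y₀⟫_ℝ) * -(⟪F z, F y₀⟫_ℝ ^ 2)⁻¹
              + (⟪F z, F y₀⟫_ℝ)⁻¹ * (⟪F z, F z⟫_ℝ * ⟪F' z v, w⟫_ℝ) := by ring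
        rw [this, e1, e2]
        field_simp
        ring
      exact (mul_eq_zero.mp key).resolve_left hFz
    have hdiff : DifferentiableOn ℝ (fun z => ⟪F z, w⟫_ℝ * (⟪F z, F y₀⟫_ℝ)⁻¹) (ball y₀ r) :=
      fun z hz => (hder z hz).differentiableAt.differentiableWithinAt
    have hzero : (ball y₀ r).EqOn (fderiv ℝ (fun z => ⟪F z, w⟫_ℝ * (⟪F z, F y₀⟫_ℝ)⁻¹)) 0 :=
      fun z hz => (hder z hz).fderiv
    exact isOpen_ball.is_const_of_fderiv_eq_zero (convex_ball y₀ r).isPreconnected hdiff hzero hy (mem_ball_self hr)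
  -- clear denominators and read the vector identity off its inner products
  have hq0 : ⟪F y₀, F y₀⟫_ℝ ≠ 0 := hne y₀ (mem_ball_self hr)
  have hqy : ⟪F y, F y₀⟫_ℝ ≠ 0 := hne y hy
  apply ext_inner_right ℝ
  intro w
  rw [real_inner_smul_left, real_inner_smul_left]
  have := hconst w
  field_simp at this
  linear_combination this

/-! ## The identity principle for `det[a, y, ∇Y(y)]` -/

section SolidHarmonic

variable {l : ℕ} {Y : E3 → ℝ}

/-- a solid harmonic is real-analytic. -/
theorem IsSolidHarmonic.analyticOnNhd (hY : IsSolidHarmonic l Y) : AnalyticOnNhd ℝ Y univ := by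
  obtain ⟨P, -, hP⟩ := hY.1
  have h := AnalyticOnNhd.eval_continuousLinearMap' (𝕜 := ℝ) (fun i : Fin 3 => (EuclideanSpace.proj i : E3 →L[ℝ] ℝ)) P
  have hfun : Y = fun y : E3 => MvPolynomial.eval (fun i => (EuclideanSpace.proj i : E3 →L[ℝ] ℝ) y) P := by
    funext y; rw [hP]; rfl
  rw [hfun]; exact h

/-- a component of the gradient is a directional derivative. -/
theorem gradient_apply_eq_fderiv (Y : E3 → ℝ) (y : E3) (i : Fin 3) : gradient Y y i = fderiv ℝ Y y (e i) := by
  have h1 : ⟪gradient Y y, e i⟫_ℝ = gradient Y y i := by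
    rw [e, EuclideanSpace.inner_single_right, one_mul, conj_trivial]
  have h2 : ⟪gradient Y y, e i⟫_ℝ = fderiv ℝ Y y (e i) := by
    show ⟪(InnerProductSpace.toDual ℝ E3).symm (fderiv ℝ Y y), e i⟫_ℝ = _
    rw [InnerProductSpace.toDual_symm_apply]
  rw [← h1, h2]

/-- `y ↦ det[a, y, ∇Y(y)]` is real-analytic for a solid harmonic `Y`. -/
theorem IsSolidHarmonic.analyticOnNhd_det3 (hY : IsSolidHarmonic l Y) (a : E3) :
    AnalyticOnNhd ℝ (fun y : E3 => det3 a y (gradient Y y)) univ := by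
  have hD : AnalyticOnNhd ℝ (fderiv ℝ Y) univ := hY.analyticOnNhd.fderiv
  have hG : ∀ i : Fin 3, AnalyticOnNhd ℝ (fun y : E3 => gradient Y y i) univ := by
    intro i
    have hfun : (fun y : E3 => gradient Y y i) = fun y => (ContinuousLinearMap.apply ℝ ℝ (e i)) (fderiv ℝ Y y) := by
      funext y; rw [gradient_apply_eq_fderiv]; rfl
    rw [hfun]
    exact (ContinuousLinearMap.apply ℝ ℝ (e i)).comp_analyticOnNhd hD
  have hC : ∀ i : Fin 3, AnalyticOnNhd ℝ (fun y : E3 => y i) univ := fun i =>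
    (EuclideanSpace.proj i : E3 →L[ℝ] ℝ).analyticOnNhd univ
  have hK : AnalyticOnNhd ℝ (fun _ : E3 => a 0) univ := analyticOnNhd_const
  have hK1 : AnalyticOnNhd ℝ (fun _ : E3 => a 1) univ := analyticOnNhd_const
  have hK2 : AnalyticOnNhd ℝ (fun _ : E3 => a 2) univ := analyticOnNhd_const
  have hφ : (fun y : E3 => det3 a y (gradient Y y)) = fun y : E3 =>
      a 0 * (y 1 * gradient Y y 2 - y 2 * gradient Y y 1) - a 1 * (y 0 * gradient Y y 2 - y 2 * gradient Y y 0)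
        + a 2 * (y 0 * gradient Y y 1 - y 1 * gradient Y y 0) := rfl
  rw [hφ]
  exact ((hK.mul (((hC 1).mul (hG 2)).sub ((hC 2).mul (hG 1)))).sub
    (hK1.mul (((hC 0).mul (hG 2)).sub ((hC 2).mul (hG 0))))).add
    (hK2.mul (((hC 0).mul (hG 1)).sub ((hC 1).mul (hG 0))))

/-- IDENTITY PRINCIPLE: if `det[a, y, ∇Y(y)] = 0` on a ball then `Y` is zonal about `a`. -/
theorem IsSolidHarmonic.isZonalAbout_of_ball (hY : IsSolidHarmonic l Y) {a y₀ : E3} {r : ℝ} (hr : 0 < r)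
    (h : ∀ y ∈ ball y₀ r, det3 a y (gradient Y y) = 0) : IsZonalAbout a Y := by
  intro y
  have hev : (fun y : E3 => det3 a y (gradient Y y)) =ᶠ[𝓝 y₀] 0 :=
    Filter.eventuallyEq_iff_exists_mem.2 ⟨ball y₀ r, ball_mem_nhds y₀ hr, fun z hz => h z hz⟩
  have := (hY.analyticOnNhd_det3 a).eqOn_zero_of_preconnected_of_eventuallyEq_zero isPreconnected_univ (mem_univ y₀) hev
  exact this (mem_univ y)

/-! ## The axis field and its derivative at a point with `y × ∇Y ≠ 0` -/

/-- THE AXIS FIELD IS PARALLEL TO ITS OWN DERIVATIVE.  At a point `y` with `y × ∇Y(y) ≠ 0`, the field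
`A(z) = ∇Y(z) − (⟪Hess Y(z)·R(z), R(z)⟫ · ‖R(z)‖⁻²) z`, `R(z) = z × ∇Y(z)`, is differentiable with `A′v × A(y) = 0` for every `v`
(quotient rule + the pointwise KEY identity `cross_axisDeriv_axis_eq_zero` fed by the jets of `Y`). -/
theorem IsSolidHarmonic.exists_hasFDerivAt_axis (hY : IsSolidHarmonic l Y) (hA : ∀ y : E3, angForm Y y = 0) {y : E3}
    (hR : cross y (gradient Y y) ≠ 0) :
    ∃ A' : E3 →L[ℝ] E3,
      HasFDerivAt (fun z : E3 => gradient Y z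
        + (-(⟪fderiv ℝ (gradient Y) z (cross z (gradient Y z)), cross z (gradient Y z)⟫_ℝ
            * (⟪cross z (gradient Y z), cross z (gradient Y z)⟫_ℝ)⁻¹)) • z) A' y ∧
      ∀ v : E3, cross (A' v) (gradient Y y
        + (-(⟪fderiv ℝ (gradient Y) y (cross y (gradient Y y)), cross y (gradient Y y)⟫_ℝ
            * (⟪cross y (gradient Y y), cross y (gradient Y y)⟫_ℝ)⁻¹)) • y) = 0 := by
  have hρ0 : ⟪cross y (gradient Y y), cross y (gradient Y y)⟫_ℝ ≠ 0 := (real_inner_self_pos.mpr hR).ne'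
  -- derivative data
  have hg : HasFDerivAt (gradient Y) (fderiv ℝ (gradient Y) y) y :=
    ((hY.contDiff_gradient.differentiable (by simp)) y).hasFDerivAt
  have hSf : HasFDerivAt (fderiv ℝ (gradient Y)) (fderiv ℝ (fderiv ℝ (gradient Y)) y) y :=
    ((hY.contDiff_hessian.differentiable (by simp)) y).hasFDerivAt
  have hRot := hY.hasFDerivAt_rot y
  have hSR := hSf.clm_apply hRot
  have hnum := hSR.inner (𝕜 := ℝ) hRot
  have hden := hRot.inner (𝕜 := ℝ) hRot
  have hinv := (hasFDerivAt_inv hρ0).comp y hden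
  have hc := (hnum.mul hinv).neg
  have hAx := hg.add (hc.smul (hasFDerivAt_id y))
  refine ⟨_, hAx, fun v => ?_⟩
  clear hAx hc hinv hden hnum hSR
  -- unfold the derivative applied to `v`
  simp only [_root_.add_apply, _root_.smul_apply, ContinuousLinearMap.id_apply,
    ContinuousLinearMap.smulRight_apply, _root_.neg_apply, ContinuousLinearMap.comp_apply,
    ContinuousLinearMap.prod_apply, fderivInnerCLM_apply, ContinuousLinearMap.toSpanSingleton_apply,
    ContinuousLinearMap.flip_apply, ContinuousLinearMap.precompR_apply, ContinuousLinearMap.compL_apply,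
    ContinuousLinearMap.precompL_apply, Literature.Analysis.FluidPDE.crossCLM_apply, smul_eq_mul, Function.comp_apply,
    Pi.neg_apply, Pi.mul_apply, id_eq]
  -- the jets of `Y` at `y`
  have hH : ⟪cross y (gradient Y y), fderiv ℝ (gradient Y) y (gradient Y y)⟫_ℝ = 0 := by
    have := hA y
    rw [hY.angForm_eq] at this
    simpa using this
  have hdH : ∀ w : E3, ⟪cross w (gradient Y y) + cross y (fderiv ℝ (gradient Y) y w), fderiv ℝ (gradient Y) y (gradient Y y)⟫_ℝ
      + ⟪cross y (gradient Y y), fderiv ℝ (fderiv ℝ (gradient Y)) y w (gradient Y y) + fderiv ℝ (gradient Y) y (fderiv ℝ (gradient Y) y w)⟫_ℝ = 0 := by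
    intro w
    have := hY.fderiv_angForm_eq_zero hA y w
    rw [add_comm (cross y (fderiv ℝ (gradient Y) y w)) (cross w (gradient Y y)),
      add_comm (fderiv ℝ (gradient Y) y (fderiv ℝ (gradient Y) y w)) (fderiv ℝ (fderiv ℝ (gradient Y)) y w (gradient Y y))] at this
    exact this
  have hc' : (-(⟪fderiv ℝ (gradient Y) y (cross y (gradient Y y)), cross y (gradient Y y)⟫_ℝ * (⟪cross y (gradient Y y), cross y (gradient Y y)⟫_ℝ)⁻¹)) * ⟪cross y (gradient Y y), cross y (gradient Y y)⟫_ℝ = -⟪fderiv ℝ (gradient Y) y (cross y (gradient Y y)), cross y (gradient Y y)⟫_ℝ := by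
    field_simp
  have hDD : (cross y (fderiv ℝ (gradient Y) y v) + cross v (gradient Y y)) = (cross v (gradient Y y) + cross y (fderiv ℝ (gradient Y) y v)) := add_comm _ _
  have hdc' : (-(⟪fderiv ℝ (gradient Y) y (cross y (gradient Y y)), cross y (gradient Y y)⟫_ℝ * ((⟪cross y (gradient Y y), (cross y (fderiv ℝ (gradient Y) y v) + cross v (gradient Y y))⟫_ℝ + ⟪(cross y (fderiv ℝ (gradient Y) y v) + cross v (gradient Y y)), cross y (gradient Y y)⟫_ℝ) * -(⟪cross y (gradient Y y), cross y (gradient Y y)⟫_ℝ ^ 2)⁻¹) + (⟪cross y (gradient Y y), cross y (gradient Y y)⟫_ℝ)⁻¹ * (⟪fderiv ℝ (gradient Y) y (cross y (gradient Y y)), (cross y (fderiv ℝ (gradient Y) y v) + cross v (gradient Y y))⟫_ℝ + ⟪fderiv ℝ (gradient Y) y (cross y (fderiv ℝ (gradient Y) y v) + cross v (gradient Y y)) + fderiv ℝ (fderiv ℝ (gradient Y)) y v (cross y (gradient Y y)), cross y (gradient Y y)⟫_ℝ))) * ⟪cross y (gradient Y y), cross y (gradient Y y)⟫_ℝ ^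 2 =
      -((⟪fderiv ℝ (fderiv ℝ (gradient Y)) y v (cross y (gradient Y y)) + fderiv ℝ (gradient Y) y (cross v (gradient Y y) + cross y (fderiv ℝ (gradient Y) y v)), cross y (gradient Y y)⟫_ℝ + ⟪fderiv ℝ (gradient Y) y (cross y (gradient Y y)), (cross v (gradient Y y) + cross y (fderiv ℝ (gradient Y) y v))⟫_ℝ) * ⟪cross y (gradient Y y), cross y (gradient Y y)⟫_ℝ
        - ⟪fderiv ℝ (gradient Y) y (cross y (gradient Y y)), cross y (gradient Y y)⟫_ℝ * (⟪(cross v (gradient Y y) + cross y (fderiv ℝ (gradient Y) y v)), cross y (gradient Y y)⟫_ℝ + ⟪cross y (gradient Y y), (cross v (gradient Y y) + cross y (fderiv ℝ (gradient Y) y v))⟫_ℝ)) := by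
    rw [hDD, add_comm (fderiv ℝ (gradient Y) y (cross v (gradient Y y) + cross y (fderiv ℝ (gradient Y) y v))) (fderiv ℝ (fderiv ℝ (gradient Y)) y v (cross y (gradient Y y)))]
    field_simp
    ring
  have key := cross_axisDeriv_axis_eq_zero (l : ℝ) (Y y) (-(⟪fderiv ℝ (gradient Y) y (cross y (gradient Y y)), cross y (gradient Y y)⟫_ℝ * (⟪cross y (gradient Y y), cross y (gradient Y y)⟫_ℝ)⁻¹)) (-(⟪fderiv ℝ (gradient Y) y (cross y (gradient Y y)), cross y (gradient Y y)⟫_ℝ * ((⟪cross y (gradient Y y), (cross y (fderiv ℝ (gradient Y) y v) + cross v (gradient Y y))⟫_ℝ + ⟪(cross y (fderiv ℝ (gradient Y) y v) + cross v (gradient Y y)), cross y (gradient Y y)⟫_ℝ) * -(⟪cross y (gradient Y y), cross y (gradient Y y)⟫_ℝ ^ 2)⁻¹) + (⟪cross y (gradient Y y), cross y (gradient Y y)⟫_ℝ)⁻¹ * (⟪fderiv ℝ (gradient Y) y (cross y (gradient Y y)), (cross y (fderiv ℝ (gradient Y) y v) + cross v (gradient Y y))⟫_ℝ + ⟪fderiv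 ℝ (gradient Y) y (cross y (fderiv ℝ (gradient Y) y v) + cross v (gradient Y y)) + fderiv ℝ (fderiv ℝ (gradient Y)) y v (cross y (gradient Y y)), cross y (gradient Y y)⟫_ℝ))) y (gradient Y y) v (fderiv ℝ (gradient Y) y) (fderiv ℝ (fderiv ℝ (gradient Y)) y)
    (fun u w => hY.hessian_symm y u w) (fun u w => hY.third_symm y u w) (fun u w z => hY.third_symm' y u w z)
    (hY.inner_self_gradient y) (hY.hessian_apply_self y) (fun w => hY.third_apply_self y w)
    (hY.trace_hessian y) (fun w => hY.trace_third y w) hH hdH hR hc' hdc'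
  rw [show ∀ p q r : E3, p + (q + r) = p + r + q from fun p q r => by abel]
  exact key

/-! ## The ANGULAR LEMMA S-C in every degree -/

/-- **S-C `AngularLemma` BY NAME (every degree `l`)**: a solid harmonic `Y` with `{Y,|∇Y|²} ≡ 0` is zonal. -/
theorem angularLemma_holds : AngularLemma := by
  intro l Y hY hA
  by_cases hex : ∃ y₀ : E3, cross y₀ (gradient Y y₀) ≠ 0
  · obtain ⟨y₀, hy₀⟩ := hex
    -- the axis field
    set F : E3 → E3 := fun z : E3 => gradient Y z
      + (-(⟪fderiv ℝ (gradient Y) z (cross z (gradient Y z)), cross z (gradient Y z)⟫_ℝ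
          * (⟪cross z (gradient Y z), cross z (gradient Y z)⟫_ℝ)⁻¹)) • z with hF
    -- `F` is orthogonal to the rotation field, and nonzero where the rotation field is
    have hFR : ∀ z : E3, ⟪F z, cross z (gradient Y z)⟫_ℝ = 0 := by
      intro z
      simp only [hF, inner_add_left, real_inner_smul_left]
      rw [real_inner_comm (cross z (gradient Y z)) (gradient Y z), inner_cross_self_snd,
        real_inner_comm (cross z (gradient Y z)) z, inner_cross_self_fst]
      ring
    have hFne : ∀ z : E3, cross z (gradient Y z) ≠ 0 → F z ≠ 0 := by
      intro z hz hFz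
      apply hz
      have hgz : gradient Y z = (⟪fderiv ℝ (gradient Y) z (cross z (gradient Y z)), cross z (gradient Y z)⟫_ℝ
          * (⟪cross z (gradient Y z), cross z (gradient Y z)⟫_ℝ)⁻¹) • z := by
        have : F z = 0 := hFz
        simp only [hF] at this
        rw [neg_smul, ← sub_eq_add_neg, sub_eq_zero] at this
        exact this
      -- `z × (κ z) = 0`
      have hc0 : ∀ κ : ℝ, cross z (κ • z) = 0 := fun κ => by
        ext i; fin_cases i <;> simp [cross_apply_zero, cross_apply_one, cross_apply_two] <;> ring
      rw [hgz]; exact hc0 _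
    -- a ball on which `R ≠ 0` and `⟪F, F y₀⟫ ≠ 0`
    obtain ⟨A'₀, hA'₀, -⟩ := hY.exists_hasFDerivAt_axis hA hy₀
    have hFcont : ContinuousAt F y₀ := hA'₀.continuousAt
    have hRcont : ContinuousAt (fun z : E3 => cross z (gradient Y z)) y₀ := (hY.hasFDerivAt_rot y₀).continuousAt
    have h1 : ∀ᶠ z in 𝓝 y₀, cross z (gradient Y z) ≠ 0 := hRcont.eventually_ne hy₀
    have h2 : ∀ᶠ z in 𝓝 y₀, ⟪F z, F y₀⟫_ℝ ≠ 0 := by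
      have hc : ContinuousAt (fun z => ⟪F z, F y₀⟫_ℝ) y₀ := hFcont.inner continuousAt_const
      exact hc.eventually_ne (by
        show ⟪F y₀, F y₀⟫_ℝ ≠ 0
        exact (real_inner_self_pos.mpr (hFne y₀ hy₀)).ne')
    obtain ⟨r, hr, hball⟩ := Metric.eventually_nhds_iff_ball.mp (h1.and h2)
    -- on the ball: derivative parallel to the field
    have hder : ∀ z ∈ ball y₀ r, ∃ A' : E3 →L[ℝ] E3, HasFDerivAt F A' z ∧ ∀ v, cross (A' v) (F z) = 0 :=
      fun z hz => hY.exists_hasFDerivAt_axis hA (hball z hz).1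
    choose! F' hF' hpar using hder
    have hparallel : ∀ z ∈ ball y₀ r, ⟪F y₀, F y₀⟫_ℝ • F z = ⟪F z, F y₀⟫_ℝ • F y₀ :=
      fun z hz => parallel_of_cross_fderiv_eq_zero hF' hpar (fun w hw => (hball w hw).2) hz
    -- hence `det[F y₀, z, ∇Y(z)] = 0` on the ball
    have hdet : ∀ z ∈ ball y₀ r, det3 (F y₀) z (gradient Y z) = 0 := by
      intro z hz
      rw [det3_eq_inner_cross]
      have hq : ⟪F z, F y₀⟫_ℝ ≠ 0 := (hball z hz).2
      have := congrArg (fun u => ⟪u, cross z (gradient Y z)⟫_ℝ) (hparallel z hz)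
      simp only [real_inner_smul_left, hFR z, mul_zero] at this
      exact (mul_eq_zero.mp this.symm).resolve_left hq
    exact ⟨F y₀, hFne y₀ hy₀, hY.isZonalAbout_of_ball hr hdet⟩
  · -- degenerate case: the rotation field vanishes identically, `Y` is zonal about every axis
    push Not at hex
    refine ⟨e 0, ?_, fun y => ?_⟩
    · intro h0
      have := congrArg (fun u : E3 => u 0) h0
      simp [e] at this
    · rw [det3_eq_inner_cross, hex y, inner_zero_right]

end SolidHarmonic

end Summit.NavierStokesRegularity.NavierStokesRegularity.Theorems.UnthreadedRigidity.VirialHorn
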